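import Literature.MathematicalPhysics.QuantumLattice.InfVolFermionStateBounds
import Literature.MathematicalPhysics.QuantumLattice.FermionEmbedLocality
import Literature.MathematicalPhysics.QuantumLattice.HubbardJordanWignerLocality
import HarnessLib

/-!
# Translation-invariant states of the lattice fermion system are even

Topic `Literature/MathematicalPhysics/QuantumLattice`; namespace
`Literature.MathematicalPhysics.QuantumLattice` (the file path). Vocabulary of `InfVolFermionState.lean`
(`InfVolFermionState`, `IsTranslationInvariant`, `IsEven`, `fermionEmbed`, `parityAut`). Everything is
PROVED; no definition, no named fact.

## Results

* `fermionEmbed_mul_fermionEmbed_of_odd_of_disjoint` — **graded commutativity, odd–odd case**: odd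
  elements (`Θ a = -a`) of the local algebras of two DISJOINT regions ANTIcommute after embedding into a
  common region (Bratteli–Robinson II §5.2.2; the even–anything case is the tree's
  `commute_of_mem_carEvenSubalgebra`). Tool: `letterOp_mul_fermionEmbed_of_odd` (a generator `c^♯`
  outside the image anticommutes with an embedded odd element), by the Majorana factorisation
  `a = γ (γ a)`, `γ = c + c†`, `γ² = 1`, `γ a` even.
* `InfVolFermionState.normSq_expect_le` — the **Cauchy–Schwarz inequality** of a state,
  `‖ω_Λ(B)‖² ≤ Re ω_Λ(Bᴴ B)` (Bratteli–Robinson I Lemma 2.3.10 (b) with `A = 𝟙`).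
* `InfVolFermionState.IsTranslationInvariant.expect_eq_zero_of_odd` and
  `InfVolFermionState.IsTranslationInvariant.isEven` — **a translation-invariant state of the CAR
  algebra over `ℤ^d`, `d ≥ 1`, vanishes on odd elements, i.e. is even.** Araki–Moriya (2003) §4.1,
  Remark 1 after Def. 4.5 ("any translation invariant state is automatically `Θ`-even"); Bratteli–Robinson
  II, Example 5.2.21. Proof (the standard one): for an odd Hermitian `O ∈ 𝔄_Λ` and `n` far-apart
  translates `O_j = τ_{jv} O` (pairwise anticommuting), `B = Σ_j O_j` has `B² = Σ_j O_j²`, so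
  `n² |ω(O)|² = |ω(B)|² ≤ ω(B²) = n ω(O²) ≤ n ‖O²‖`, whence `ω(O) = 0`. For `d = 0` the statement is false
  (a single site has non-even states), hence the hypothesis `0 < d`.

## References

* [ArakiMoriya2003] H. Araki, H. Moriya, Rev. Math. Phys. 15 (2003) 93, §4.1 Def. 4.5 and Remark 1.
* [BratteliRobinsonII1997] O. Bratteli, D. W. Robinson, OAQSM 2, §5.2.2 (CAR algebra, even/odd parts).
* [BratteliRobinsonI1987] O. Bratteli, D. W. Robinson, OAQSM 1, Lemma 2.3.10 (Cauchy–Schwarz).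
-/

noncomputable section

namespace Literature.MathematicalPhysics.QuantumLattice

open Matrix Finset HubbardWave0 Literature.Probability.LatticeModels
open scoped ComplexOrder

/-! ### §1. Odd elements of disjoint regions anticommute -/

section Graded

variable {Λ₁ Λ₂ Λ' : Type*} [LinearOrder Λ₁] [Fintype Λ₁] [LinearOrder Λ₂] [Fintype Λ₂]
  [LinearOrder Λ'] [Fintype Λ']

omit [LinearOrder Λ'] [Fintype Λ'] [LinearOrder Λ₂] [Fintype Λ₂] in
/-- On an empty set of sites every operator is even (`(-1)^N = 1`), so an odd one vanishes. [folklore] -/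
private theorem eq_zero_of_odd_of_isEmpty [IsEmpty Λ₁] {a : Matrix (Finset (Orb Λ₁)) (Finset (Orb Λ₁)) ℂ}
    (ha : parityAut a = -a) : a = 0 := by
  have hP : (parityOp : Matrix (Finset (Orb Λ₁)) (Finset (Orb Λ₁)) ℂ) = 1 := by
    rw [parityOp, ← Matrix.diagonal_one]
    congr 1
    funext s
    have hs : s = ∅ := Finset.eq_empty_of_forall_notMem fun i _ => isEmptyElim (ofLex i).1
    rw [hs, Finset.card_empty, pow_zero]
  have h1 : parityAut a = a := by rw [parityAut_apply, hP, Matrix.one_mul, Matrix.mul_one]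
  have h2 : (2 : ℂ) • a = 0 := by
    rw [two_smul]
    exact eq_neg_iff_add_eq_zero.1 (h1.symm.trans ha)
  exact (smul_eq_zero.1 h2).resolve_left two_ne_zero

omit [LinearOrder Λ'] [Fintype Λ'] [LinearOrder Λ₂] [Fintype Λ₂] in
/-- The Majorana element `γ = c_{x↑} + c†_{x↑}` of a site: `γ² = 1` and `γ` is odd. [folklore] -/
private theorem majorana_mul_self (x : Λ₁) :
    (annihilation (orb x 0) + creation (orb x 0) : Matrix (Finset (Orb Λ₁)) (Finset (Orb Λ₁)) ℂ) *
        (annihilation (orb x 0) + creation (orb x 0)) = 1 := by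
  have hcc : annihilation (orb x 0) * annihilation (orb x 0) =
      (0 : Matrix (Finset (Orb Λ₁)) (Finset (Orb Λ₁)) ℂ) := by
    have h2 : (2 : ℂ) • (annihilation (orb x 0) * annihilation (orb x 0)) =
        (0 : Matrix (Finset (Orb Λ₁)) (Finset (Orb Λ₁)) ℂ) := by
      rw [two_smul]
      exact annihilation_anticommute_holds (ι := Orb Λ₁) (orb x 0) (orb x 0)
    exact (smul_eq_zero.1 h2).resolve_left two_ne_zero
  have hmix := annihilation_mul_creation_add_creation_mul_annihilation_holds (ι := Orb Λ₁)
    (orb x 0) (orb x 0)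
  rw [if_pos rfl] at hmix
  rw [Matrix.add_mul, Matrix.mul_add, Matrix.mul_add, hcc, creation_mul_self, zero_add, add_zero]
  exact hmix

omit [LinearOrder Λ'] [Fintype Λ'] [LinearOrder Λ₂] [Fintype Λ₂] in
/-- The Majorana element is odd. [folklore] -/
private theorem parityAut_majorana (x : Λ₁) :
    parityAut (annihilation (orb x 0) + creation (orb x 0) : Matrix (Finset (Orb Λ₁)) (Finset (Orb Λ₁)) ℂ) =
      -(annihilation (orb x 0) + creation (orb x 0)) := by
  rw [map_add, parityAut_annihilation, parityAut_creation, neg_add]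

omit [LinearOrder Λ₂] [Fintype Λ₂] in
/-- `Γ(φ) γ` is the sum of the two generators at the image orbital. [folklore] -/
private theorem fermionEmbed_majorana (φ : Λ₁ ↪ Λ') (x : Λ₁) :
    fermionEmbed φ (annihilation (orb x 0) + creation (orb x 0)) =
      letterOp ((orb (φ x) 0, false) : JWLetter (Orb Λ')) + letterOp ((orb (φ x) 0, true) : JWLetter (Orb Λ')) := by
  rw [map_add, fermionEmbed_annihilation, fermionEmbed_creation]
  rfl

omit [LinearOrder Λ₁] [Fintype Λ₁] in
/-- **A generator outside the image anticommutes with an embedded odd element**: for `ψ : Λ₂ ↪ Λ'`,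
a letter `l` (some `c_i` or `c†_i`) with `i ∉ orbs (ψ Λ₂)` and `Θ b = -b`,
`c^♯_i Γ(ψ) b = -Γ(ψ) b c^♯_i`. [cite: BratteliRobinsonII1997, §5.2.2 (graded commutation relations)] -/
theorem letterOp_mul_fermionEmbed_of_odd (ψ : Λ₂ ↪ Λ') (l : JWLetter (Orb Λ'))
    (hl : l.1 ∉ orbs ((Finset.univ : Finset Λ₂).map ψ))
    {b : Matrix (Finset (Orb Λ₂)) (Finset (Orb Λ₂)) ℂ} (hb : parityAut b = -b) :
    letterOp l * fermionEmbed ψ b = -(fermionEmbed ψ b * letterOp l) := by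
  rcases isEmpty_or_nonempty Λ₂ with hΛ | ⟨⟨y₀⟩⟩
  · rw [eq_zero_of_odd_of_isEmpty hb, map_zero, Matrix.mul_zero, Matrix.zero_mul, neg_zero]
  · set γ : Matrix (Finset (Orb Λ₂)) (Finset (Orb Λ₂)) ℂ :=
      annihilation (orb y₀ 0) + creation (orb y₀ 0) with hγ_def
    have hγ2 : γ * γ = 1 := majorana_mul_self y₀
    have heven : parityAut (γ * b) = γ * b := by
      rw [map_mul, hγ_def, parityAut_majorana, hb, neg_mul_neg]
    -- the letter `l` is at an orbital different from the image orbital of `y₀`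
    have hne : (orb (ψ y₀) 0 : Orb Λ') ≠ l.1 := by
      intro h
      apply hl
      rw [← h, orb_mem_orbs]
      exact Finset.mem_map_of_mem _ (Finset.mem_univ _)
    -- `l` anticommutes with `Γ γ`
    have hγl : letterOp l * fermionEmbed ψ γ = -(fermionEmbed ψ γ * letterOp l) := by
      rw [hγ_def, fermionEmbed_majorana, Matrix.mul_add, Matrix.add_mul,
        letterOp_mul_letterOp_of_ne (l := l) (l' := (orb (ψ y₀) 0, false)) (Ne.symm hne),
        letterOp_mul_letterOp_of_ne (l := l) (l' := (orb (ψ y₀) 0, true)) (Ne.symm hne), neg_add]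
    -- `l` commutes with the even `Γ (γ b)`
    have hcomm : Commute (fermionEmbed ψ (γ * b)) (letterOp l) := by
      refine commute_of_mem_carEvenSubalgebra
        (fermionEmbed_mem_carEvenSubalgebra ψ (JordanWigner.mem_carEvenSubalgebra_univ_of_parityAut_eq heven))
        (letterOp_mem_carSubalgebra (S := {l.1}) (Finset.mem_singleton_self _)) ?_
      exact Finset.disjoint_singleton_right.2 hl
    calc letterOp l * fermionEmbed ψ b
        = letterOp l * fermionEmbed ψ (γ * (γ * b)) := by rw [← Matrix.mul_assoc, hγ2, Matrix.one_mul]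
      _ = letterOp l * fermionEmbed ψ γ * fermionEmbed ψ (γ * b) := by rw [map_mul, Matrix.mul_assoc]
      _ = -(fermionEmbed ψ γ * (letterOp l * fermionEmbed ψ (γ * b))) := by
          rw [hγl, Matrix.neg_mul, Matrix.mul_assoc]
      _ = -(fermionEmbed ψ γ * (fermionEmbed ψ (γ * b) * letterOp l)) := by rw [hcomm.eq]
      _ = -(fermionEmbed ψ b * letterOp l) := by
          rw [← Matrix.mul_assoc, ← map_mul, ← Matrix.mul_assoc, hγ2, Matrix.one_mul]

/-- **Odd elements of disjoint regions anticommute**: for embeddings `φ : Λ₁ ↪ Λ'`, `ψ : Λ₂ ↪ Λ'` with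
disjoint images and odd `a`, `b` (`Θ a = -a`, `Θ b = -b`), `Γ(φ) a · Γ(ψ) b = -Γ(ψ) b · Γ(φ) a`.
[cite: BratteliRobinsonII1997, §5.2.2 (graded commutation relations)] -/
theorem fermionEmbed_mul_fermionEmbed_of_odd_of_disjoint (φ : Λ₁ ↪ Λ') (ψ : Λ₂ ↪ Λ')
    (hdisj : Disjoint ((Finset.univ : Finset Λ₁).map φ) ((Finset.univ : Finset Λ₂).map ψ))
    {a : Matrix (Finset (Orb Λ₁)) (Finset (Orb Λ₁)) ℂ} (ha : parityAut a = -a)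
    {b : Matrix (Finset (Orb Λ₂)) (Finset (Orb Λ₂)) ℂ} (hb : parityAut b = -b) :
    fermionEmbed φ a * fermionEmbed ψ b = -(fermionEmbed ψ b * fermionEmbed φ a) := by
  rcases isEmpty_or_nonempty Λ₁ with hΛ | ⟨⟨x₀⟩⟩
  · rw [eq_zero_of_odd_of_isEmpty ha, map_zero, Matrix.mul_zero, Matrix.zero_mul, neg_zero]
  · set γ : Matrix (Finset (Orb Λ₁)) (Finset (Orb Λ₁)) ℂ :=
      annihilation (orb x₀ 0) + creation (orb x₀ 0) with hγ_def
    have hγ2 : γ * γ = 1 := majorana_mul_self x₀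
    have heven : parityAut (γ * a) = γ * a := by
      rw [map_mul, hγ_def, parityAut_majorana, ha, neg_mul_neg]
    have hx₀ : (orb (φ x₀) 0 : Orb Λ') ∉ orbs ((Finset.univ : Finset Λ₂).map ψ) := by
      intro h
      rw [orb_mem_orbs] at h
      exact Finset.disjoint_left.1 hdisj (Finset.mem_map_of_mem _ (Finset.mem_univ x₀)) h
    -- `Γ γ` anticommutes with `Γ(ψ) b`
    have hγb : fermionEmbed φ γ * fermionEmbed ψ b = -(fermionEmbed ψ b * fermionEmbed φ γ) := by
      rw [hγ_def, fermionEmbed_majorana, Matrix.add_mul, Matrix.mul_add,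
        letterOp_mul_fermionEmbed_of_odd ψ _ hx₀ hb, letterOp_mul_fermionEmbed_of_odd ψ _ hx₀ hb, neg_add]
    -- the even `Γ(φ) (γ a)` commutes with `Γ(ψ) b`
    have hcomm : Commute (fermionEmbed φ (γ * a)) (fermionEmbed ψ b) :=
      commute_of_mem_carEvenSubalgebra
        (fermionEmbed_mem_carEvenSubalgebra φ (JordanWigner.mem_carEvenSubalgebra_univ_of_parityAut_eq heven))
        (fermionEmbed_mem_carSubalgebra ψ b) (disjoint_orbs hdisj)
    calc fermionEmbed φ a * fermionEmbed ψ b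
        = fermionEmbed φ (γ * (γ * a)) * fermionEmbed ψ b := by
          rw [← Matrix.mul_assoc, hγ2, Matrix.one_mul]
      _ = fermionEmbed φ γ * (fermionEmbed φ (γ * a) * fermionEmbed ψ b) := by
          rw [map_mul, Matrix.mul_assoc]
      _ = fermionEmbed φ γ * fermionEmbed ψ b * fermionEmbed φ (γ * a) := by
          rw [hcomm.eq, Matrix.mul_assoc]
      _ = -(fermionEmbed ψ b * (fermionEmbed φ γ * fermionEmbed φ (γ * a))) := by
          rw [hγb, Matrix.neg_mul, Matrix.mul_assoc]
      _ = -(fermionEmbed ψ b * fermionEmbed φ a) := by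
          rw [← map_mul, ← Matrix.mul_assoc, hγ2, Matrix.one_mul]

end Graded

/-! ### §2. Cauchy–Schwarz for a state -/

namespace InfVolFermionState

variable {d : ℕ} (ω : InfVolFermionState d)

/-- **Cauchy–Schwarz**: `‖ω_Λ(B)‖² ≤ Re ω_Λ(Bᴴ B)` (expand `0 ≤ ω((B - λ𝟙)ᴴ(B - λ𝟙))` at
`λ = ω(B)`). Bratteli–Robinson I, Lemma 2.3.10 (b) with `A = 𝟙`. [cite: BratteliRobinsonI1987, Lemma 2.3.10] -/
theorem normSq_expect_le (Λ : Finset (Site d)) (B : FermionOp Λ) :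
    ‖ω.expect Λ B‖ ^ 2 ≤ (ω.expect Λ (Bᴴ * B)).re := by
  set z : ℂ := ω.expect Λ B with hz
  have hexp : (B - z • (1 : FermionOp Λ))ᴴ * (B - z • (1 : FermionOp Λ)) =
      Bᴴ * B - z • Bᴴ - star z • B + (z * star z) • (1 : FermionOp Λ) := by
    simp only [Matrix.conjTranspose_sub, Matrix.conjTranspose_smul, Matrix.conjTranspose_one,
      Matrix.sub_mul, Matrix.mul_sub, Matrix.smul_mul, Matrix.mul_smul, Matrix.one_mul, Matrix.mul_one,
      smul_sub, smul_smul]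
    abel
  have h := ω.expect_nonneg Λ (B - z • (1 : FermionOp Λ))
  rw [hexp, map_add, map_sub, map_sub, map_smul, map_smul, map_smul, ω.expect_one,
    ω.expect_conjTranspose, ← hz] at h
  have hre := (Complex.nonneg_iff.1 h).1
  simp only [smul_eq_mul, Complex.sub_re, Complex.add_re, Complex.mul_re, Complex.star_def,
    Complex.conj_re, Complex.conj_im, mul_one] at hre
  rw [Complex.sq_norm, Complex.normSq_apply]
  nlinarith [hre]

/-! ### §3. Translation-invariant states are even -/

/-- Far-apart translates of a finite region are pairwise disjoint: for `d ≥ 1` there is `v ∈ ℤ^d` with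
`Λ + jv` and `Λ + kv` disjoint for all natural `j ≠ k`. [folklore] -/
private theorem exists_pairwise_disjoint_shiftSet (hd : 0 < d) (Λ : Finset (Site d)) :
    ∃ v : Site d, ∀ j k : ℕ, j ≠ k →
      Disjoint (shiftSet ((j : ℤ) • v) Λ) (shiftSet ((k : ℤ) • v) Λ) := by
  set i₀ : Fin d := ⟨0, hd⟩
  set R : ℕ := Λ.sup fun x => (x i₀).natAbs with hR
  refine ⟨Pi.single i₀ ((2 * R + 1 : ℕ) : ℤ), fun j k hjk => Finset.disjoint_left.2 fun x hxj hxk => hjk ?_⟩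
  rw [mem_shiftSet] at hxj hxk
  have hb : ∀ y ∈ Λ, |y i₀| ≤ R := fun y hy => by
    have := Finset.le_sup (f := fun x : Site d => (x i₀).natAbs) hy
    rw [← Int.natCast_natAbs]
    exact_mod_cast this
  have h1 := hb _ hxj
  have h2 := hb _ hxk
  simp only [Pi.sub_apply, Pi.smul_apply, Pi.single_eq_same, smul_eq_mul] at h1 h2
  -- `|(k - j) (2R+1)| ≤ 2R` forces `j = k`
  have hdiff : |((k : ℤ) - j) * ((2 * R + 1 : ℕ) : ℤ)| ≤ 2 * R := by
    have : ((k : ℤ) - j) * ((2 * R + 1 : ℕ) : ℤ) =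
        (x i₀ - (j : ℤ) * ((2 * R + 1 : ℕ) : ℤ)) - (x i₀ - (k : ℤ) * ((2 * R + 1 : ℕ) : ℤ)) := by ring
    rw [this]
    exact (abs_sub _ _).trans (by linarith)
  by_contra hne
  have hkj : (1 : ℤ) ≤ |(k : ℤ) - j| := Int.one_le_abs (sub_ne_zero.2 (by exact_mod_cast (Ne.symm hne)))
  rw [abs_mul] at hdiff
  have hpos : (0 : ℤ) ≤ ((2 * R + 1 : ℕ) : ℤ) := by positivity
  rw [abs_of_nonneg hpos] at hdiff
  have : ((2 * R + 1 : ℕ) : ℤ) ≤ |(k : ℤ) - j| * ((2 * R + 1 : ℕ) : ℤ) :=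
    le_mul_of_one_le_left hpos hkj
  push_cast at this hdiff
  linarith

variable {ω}

/-- **A translation-invariant state vanishes on odd local observables** (`d ≥ 1`): for `Θ O = -O`,
`ω_Λ(O) = 0`. Araki–Moriya (2003) §4.1, Remark 1 after Def. 4.5; Bratteli–Robinson II Example 5.2.21.
Proof: reduce to Hermitian `O`; far-apart translates `O_j` anticommute, so `(Σ_{j<n} O_j)² = Σ_j O_j²`
and `n² |ω(O)|² ≤ n ‖Oᴴ O‖` for every `n`. [cite: ArakiMoriya2003, §4.1 Def. 4.5 Remark 1] -/
theorem IsTranslationInvariant.expect_eq_zero_of_odd (hd : 0 < d) (hω : ω.IsTranslationInvariant)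
    {Λ : Finset (Site d)} {O : FermionOp Λ} (hO : parityAut O = -O) : ω.expect Λ O = 0 := by
  -- Step 1: the Hermitian case
  suffices hherm : ∀ X : FermionOp Λ, parityAut X = -X → X.IsHermitian → ω.expect Λ X = 0 by
    -- `O = X + i Y` with `X = (O + Oᴴ)/2`, `Y = (O - Oᴴ)/(2i)` Hermitian and odd
    obtain ⟨X, hX⟩ : ∃ X : FermionOp Λ, X = (1 / 2 : ℂ) • (O + Oᴴ) := ⟨_, rfl⟩
    obtain ⟨Y, hY⟩ : ∃ Y : FermionOp Λ, Y = (-Complex.I / 2) • (O - Oᴴ) := ⟨_, rfl⟩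
    have hOct : parityAut Oᴴ = -Oᴴ := by rw [parityAut_conjTranspose, hO, Matrix.conjTranspose_neg]
    have hXodd : parityAut X = -X := by rw [hX, map_smul, map_add, hO, hOct, ← smul_neg, neg_add]
    have hYodd : parityAut Y = -Y := by
      rw [hY, map_smul, map_sub, hO, hOct, ← smul_neg, neg_sub_neg, neg_sub]
    have hXh : X.IsHermitian := by
      rw [Matrix.IsHermitian, hX, Matrix.conjTranspose_smul, Matrix.conjTranspose_add,
        Matrix.conjTranspose_conjTranspose, add_comm]
      congr 1
      norm_num
    have hYh : Y.IsHermitian := by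
      have hstar : star (-Complex.I / 2) = Complex.I / 2 := by
        rw [star_div₀, star_neg, Complex.star_def, Complex.conj_I, neg_neg, map_ofNat]
      rw [Matrix.IsHermitian, hY, Matrix.conjTranspose_smul, Matrix.conjTranspose_sub,
        Matrix.conjTranspose_conjTranspose, hstar, ← neg_sub O Oᴴ, smul_neg, ← neg_smul, neg_div]
    have hdec : O = X + Complex.I • Y := by
      rw [hX, hY, smul_smul, ← sub_eq_zero]
      have hI : Complex.I * (-Complex.I / 2) = (1 / 2 : ℂ) := by
        rw [mul_div_assoc', mul_neg, Complex.I_mul_I, neg_neg]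
      rw [hI, ← smul_add]
      have h2 : O + Oᴴ + (O - Oᴴ) = (2 : ℂ) • O := by rw [add_add_sub_cancel, two_smul]
      rw [h2, smul_smul]
      norm_num
    rw [hdec, map_add, hherm X hXodd hXh, map_smul, hherm Y hYodd hYh, smul_zero, add_zero]
  intro X hXodd hXh
  -- Step 2: far-apart translates
  obtain ⟨v, hv⟩ := exists_pairwise_disjoint_shiftSet hd Λ
  by_contra hne
  set c : ℝ := ‖ω.expect Λ X‖ ^ 2 with hc
  have hc0 : 0 < c := by rw [hc]; exact pow_pos (norm_pos_iff.2 hne) 2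
  -- the constant `C = Re ω(Xᴴ X) ≥ 0` bounding `n c ≤ C`... choose `n` with `n c > C`
  set C : ℝ := (ω.expect Λ (Xᴴ * X)).re with hC
  obtain ⟨n, hn⟩ := exists_nat_gt (C / c)
  have hnc : C < n * c := by rwa [div_lt_iff₀ hc0] at hn
  -- the region containing the first `n` translates, and the translates
  set Λn : Finset (Site d) := (Finset.range n).biUnion fun j => shiftSet ((j : ℤ) • v) Λ with hΛn
  have hsub : ∀ j ∈ Finset.range n, shiftSet ((j : ℤ) • v) Λ ⊆ Λn := fun j hj x hx => by
    rw [hΛn, Finset.mem_biUnion]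
    exact ⟨j, hj, hx⟩
  set Oj : ℕ → FermionOp Λn := fun j =>
    if hj : j ∈ Finset.range n then
      fermionEmbed ((PolySite.shiftEmb ((j : ℤ) • v) Λ).trans (PolySite.incl (hsub j hj))) X else 0 with hOj
  have hOj_eq : ∀ j (hj : j ∈ Finset.range n), Oj j =
      fermionEmbed ((PolySite.shiftEmb ((j : ℤ) • v) Λ).trans (PolySite.incl (hsub j hj))) X := fun j hj => by
    rw [hOj]; exact dif_pos hj
  -- (a) each translate has the expectation of `X`
  have hexp : ∀ j ∈ Finset.range n, ω.expect Λn (Oj j) = ω.expect Λ X := fun j hj => by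
    rw [hOj_eq j hj, ← fermionEmbed_fermionEmbed, ω.compatible (hsub j hj), ← shift_expect, hω]
  -- (b) distinct translates anticommute
  have hanti : ∀ j ∈ Finset.range n, ∀ k ∈ Finset.range n, j ≠ k → Oj j * Oj k = -(Oj k * Oj j) := by
    intro j hj k hk hjk
    rw [hOj_eq j hj, hOj_eq k hk]
    refine fermionEmbed_mul_fermionEmbed_of_odd_of_disjoint _ _ ?_ hXodd hXodd
    rw [Finset.disjoint_left]
    rintro p hpj hpk
    rw [Finset.mem_map] at hpj hpk
    obtain ⟨a, -, ha⟩ := hpj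
    obtain ⟨b, -, hb⟩ := hpk
    have ha' : ofLex p.1 = ofLex a.1 + (j : ℤ) • v := by rw [← ha]; rfl
    have hb' : ofLex p.1 = ofLex b.1 + (k : ℤ) • v := by rw [← hb]; rfl
    have hmem_j : ofLex p.1 ∈ shiftSet ((j : ℤ) • v) Λ := by
      rw [ha']; exact PolySite.add_mem_shiftSet _ (PolySite.ofLex_mem a)
    have hmem_k : ofLex p.1 ∈ shiftSet ((k : ℤ) • v) Λ := by
      rw [hb']; exact PolySite.add_mem_shiftSet _ (PolySite.ofLex_mem b)
    exact Finset.disjoint_left.1 (hv j k hjk) hmem_j hmem_k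
  -- (c) `B = Σ_j O_j` is Hermitian with `Bᴴ B = Σ_j Γ_j (Xᴴ X)`
  set B : FermionOp Λn := ∑ j ∈ Finset.range n, Oj j with hB
  have hOjh : ∀ j ∈ Finset.range n, (Oj j)ᴴ = Oj j := fun j hj => by
    rw [hOj_eq j hj, ← fermionEmbed_conjTranspose, hXh.eq]
  have hBh : Bᴴ = B := by
    rw [hB, Matrix.conjTranspose_sum]
    exact Finset.sum_congr rfl hOjh
  have hBB : Bᴴ * B = ∑ j ∈ Finset.range n, Oj j * Oj j := by
    rw [hBh, hB, Finset.sum_mul_sum, ← Finset.sum_product']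
    rw [← Finset.sum_filter_add_sum_filter_not (Finset.range n ×ˢ Finset.range n) (fun p => p.1 = p.2)]
    have hdiag : ∑ p ∈ (Finset.range n ×ˢ Finset.range n).filter (fun p => p.1 = p.2), Oj p.1 * Oj p.2 =
        ∑ j ∈ Finset.range n, Oj j * Oj j := by
      rw [Finset.sum_filter, Finset.sum_product]
      refine Finset.sum_congr rfl fun j hj => ?_
      rw [Finset.sum_ite_eq (Finset.range n) j (fun k => Oj j * Oj k)]
      simp only [hj, if_true]
      -- `sum_ite_eq` is `if j = k`; adjust orientation
    have hoff : ∑ p ∈ (Finset.range n ×ˢ Finset.range n).filter (fun p => ¬ p.1 = p.2), Oj p.1 * Oj p.2 = 0 := by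
      refine Finset.sum_involution (fun p _ => (p.2, p.1)) ?_ ?_ ?_ ?_
      · intro p hp
        rw [Finset.mem_filter, Finset.mem_product] at hp
        rw [hanti p.1 hp.1.1 p.2 hp.1.2 hp.2, neg_add_cancel]
      · intro p hp _
        rw [Finset.mem_filter] at hp
        intro h
        exact hp.2 (congrArg Prod.snd h)
      · intro p hp
        rw [Finset.mem_filter, Finset.mem_product] at hp ⊢
        exact ⟨⟨hp.1.2, hp.1.1⟩, fun h => hp.2 h.symm⟩
      · intro p _
        rfl
    rw [hdiag, hoff, add_zero]
  -- (d) `n² c ≤ n C`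
  have hωB : ω.expect Λn B = n * ω.expect Λ X := by
    rw [hB, map_sum, Finset.sum_congr rfl hexp, Finset.sum_const, Finset.card_range, nsmul_eq_mul]
  have hωBB : (ω.expect Λn (Bᴴ * B)).re = n * C := by
    rw [hBB, map_sum, Complex.re_sum]
    have : ∀ j ∈ Finset.range n, (ω.expect Λn (Oj j * Oj j)).re = C := fun j hj => by
      rw [hC, hOj_eq j hj, ← map_mul, ← fermionEmbed_fermionEmbed, ω.compatible (hsub j hj),
        ← shift_expect, hω, hXh.eq]
    rw [Finset.sum_congr rfl this, Finset.sum_const, Finset.card_range, nsmul_eq_mul]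
  have hCS := ω.normSq_expect_le Λn B
  rw [hωB, hωBB, norm_mul, mul_pow, Complex.norm_natCast, ← hc] at hCS
  -- `n² c ≤ n C < n² c` unless `n = 0`; but `C/c < n` forces `n ≥ 1` since `C ≥ 0`
  have hC0 : 0 ≤ C := by
    rw [hC]
    exact (Complex.nonneg_iff.1 (ω.expect_nonneg Λ X)).1
  have hn1 : (1 : ℝ) ≤ n := by
    have : (0 : ℝ) < n := lt_of_le_of_lt (div_nonneg hC0 hc0.le) hn
    exact_mod_cast Nat.one_le_iff_ne_zero.2 (by rintro rfl; simp at this)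
  nlinarith [hCS, hnc, hn1, hc0]

/-- **Translation-invariant states of the lattice fermion system (`d ≥ 1`) are even.**
Araki–Moriya (2003) §4.1, Remark 1 after Def. 4.5 ("any translation invariant state is `Θ`-even");
Bratteli–Robinson II, Example 5.2.21. [cite: ArakiMoriya2003, §4.1 Def. 4.5 Remark 1] -/
theorem IsTranslationInvariant.isEven (hd : 0 < d) (hω : ω.IsTranslationInvariant) : ω.IsEven := by
  intro Λ A
  have hsplit := JordanWigner.self_eq_evenPart_add_oddPart A
  have hodd := hω.expect_eq_zero_of_odd hd (JordanWigner.parityAut_oddPart A)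
  conv_lhs => rw [hsplit]
  conv_rhs => rw [hsplit]
  rw [map_add, map_add, map_add, JordanWigner.parityAut_evenPart, JordanWigner.parityAut_oddPart,
    map_neg, hodd, neg_zero]

end InfVolFermionState

end Literature.MathematicalPhysics.QuantumLattice

end
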